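import Mathlib
import HarnessLib
import Summits.Ventures.LatticeQCDFlow.Exactness.MetropolisSweepErgodic
import Summits.Ventures.LatticeQCDFlow.Exactness.SU2MetropolisKickLaw
import Summits.Ventures.LatticeQCDFlow.Exactness.U1MetropolisSweepWilson

/-!
# The engine's Metropolis sweeps at ANY `nhit ≥ 1` converge to the Wilson measure: `U(1)` (default `step 1.0, nhit 4` included) and `SU(2)`

HONEST FRAMING: exact (Metropolis-corrected) sampling algorithms for lattice gauge theory;
figures of merit are autocorrelation/cost numbers at stated couplings and volumes; no
continuum-physics claim.

Venture `LatticeQCDFlow` (cell pub-lqcd), topic `Exactness`, FANOUT row 9 (eng-latcore, the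
engine `latflow.core`: `u1_2d.U1Field2D.sweep_metropolis(β, step = 1.0, nhit = 4)` and the `SU(2)`
N-hit Metropolis sweep of `updates.sweep_metropolis` / `sun_2d.sweep_metropolis`).  NEW WORK of the
cell over the tree (`MetropolisSweepErgodic.lean`: a sweep has a Doeblin power once the kicks of one
link cover, and is exact on the product space; `U1MetropolisSweepErgodic.lean` /
`UniformKickDoubling.lean`: `2^j` uniform kicks cover `U(1)`; `SU2MetropolisKickLaw.lean`: the
engine's `SU(2)` kick dominates Lebesgue-through-the-chart near `1`; `SU2MetropolisKickCovering.lean`;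
`WilsonHeatBathErgodic.lean`: `continuous_smul_wilsonAction`).  The Wilson action and measure are
the Literature definitions of `ConstructiveQFTWave0` (`wilsonAction`, `wilsonMeasure`), used by
name; nothing here is cited as a fact.

* §1 (any compact second-countable group `G`, torus `(ℤ/L)^d`, continuous representation `ρ`, any
  `β`) `gibbsProbability_eq_wilsonMeasure` (`Z⁻¹e^{−βS_W}·Haar^{⊗edges}` IS the Literature Wilson
  measure, by `rfl`); **`wilson_metropolisSweep_uniformlyErgodic`** — for an inversion-invariant
  probability step law `ν` whose kicks cover (`(mulWalk ν)^k(u,·) ≥ δ·Haar`), every `nhit ≥ 1` and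
  every scan through all edges: the Metropolis sweep for the weight `e^{−βS_W}` converges to
  `wilsonMeasure ρ β` geometrically in total variation from EVERY initial law (through its
  `(k+1)`-st power), and `wilsonMeasure ρ β` is its ONLY invariant probability law.
* §2 `U(1)`: `u1MetropolisSweep_eq_metropolisSweep` (`rfl`: the sweep of
  `U1MetropolisSweepErgodic.lean`), `exists_u1Kick_cover`, and
  **`wilson_u1MetropolisSweep_uniformlyErgodic_of_pos`** — THE `u1_2d` METROPOLIS SWEEP AT EVERY
  `step > 0` AND EVERY `nhit ≥ 1` (the default `(1.0, 4)` included, which `U1MetropolisSweepWilson`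
  left open) converges to the `U(1)` Wilson measure from every start; unique invariant law.
* §3 `SU(2)`: `exists_su2MetropolisKick_cover` and **`wilson_su2MetropolisSweep_uniformlyErgodic`**
  — the engine's `SU(2)` Metropolis sweep (kick size `s > 0`, any `nhit ≥ 1`, any scan through all
  edges, any `β`, continuous `ρ`) converges to the `SU(2)` Wilson measure from every start, which is
  its unique invariant probability law.

NOT CLAIMED: any rate (the Doeblin constants are astronomically small and the power `k + 1` is not
computed); `SU(N ≥ 3)`; floating point; the checkerboard/threaded visiting order is a scan through
all edges and is covered as such, nothing more is said about it.
-/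

noncomputable section

namespace Summit.Ventures.LatticeQCDFlow.Exactness

open MeasureTheory ProbabilityTheory Set Function Metric
open Literature.MathematicalPhysics.QuantumFieldTheory
open Literature.MathematicalPhysics.QuantumFieldTheory.Balaban1983to89.B10Eq18SigmaSU2Haar (expPauli)
open scoped ENNReal

/-! ## §1 Any compact group: a covering step law gives a Wilson-ergodic Metropolis sweep -/

section Wilson

variable {d L N : ℕ} {G : Type*} [TopologicalSpace G] [Group G] [IsTopologicalGroup G] [CompactSpace G]
  [MeasurableSpace G] [BorelSpace G] [SecondCountableTopology G] (ρ : G →* Matrix (Fin N) (Fin N) ℂ)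
  {ν : Measure G} [IsProbabilityMeasure ν]

omit [SecondCountableTopology G] in
/-- **`Z⁻¹ e^{−βS_W} · Haar^{⊗edges}` is the Literature Wilson measure** (definitional). -/
theorem gibbsProbability_eq_wilsonMeasure [NeZero L] (β : ℝ) :
    gibbsProbability (Measure.pi fun _ : Edge d L => haarProbability G)
        (fun U : GaugeConfig d L G => Real.exp (-β * wilsonAction ρ U)) =
      wilsonMeasure (d := d) (L := L) ρ β := rfl

/-- The Wilson weight `e^{−βS_W}` is pinched between `e^{−s₀}` and `e^{s₀}` on the compact configuration
space (continuous `ρ`), and measurable. -/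
theorem wilsonBoltzmann_pinched [NeZero L] (hρ : Continuous ρ) (β : ℝ) :
    ∃ s₀ : ℝ, (∀ U : GaugeConfig d L G, Real.exp (-s₀) ≤ Real.exp (-β * wilsonAction ρ U)) ∧
      (∀ U : GaugeConfig d L G, Real.exp (-β * wilsonAction ρ U) ≤ Real.exp s₀) ∧
      Measurable fun U : GaugeConfig d L G => Real.exp (-β * wilsonAction ρ U) := by
  have hc : Continuous fun U : GaugeConfig d L G => |β * wilsonAction ρ U| :=
    continuous_abs.comp (continuous_smul_wilsonAction ρ hρ β)
  obtain ⟨U₀, -, hmax⟩ := isCompact_univ.exists_isMaxOn univ_nonempty hc.continuousOn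
  refine ⟨|β * wilsonAction ρ U₀|, fun U => ?_, fun U => ?_,
    (Real.continuous_exp.comp (continuous_smul_wilsonAction ρ hρ (-β))).measurable⟩
  · rw [Real.exp_le_exp, neg_mul]
    exact neg_le_neg (abs_le.1 ((isMaxOn_iff.1 hmax) U (mem_univ U))).2
  · rw [Real.exp_le_exp, neg_mul]
    linarith [(abs_le.1 ((isMaxOn_iff.1 hmax) U (mem_univ U))).1]

/-- **A COVERING STEP LAW GIVES A WILSON-ERGODIC METROPOLIS SWEEP.**  For an inversion-invariant
probability step law `ν` on `G` with `(mulWalk ν)^k(u,·) ≥ δ · Haar` from every `u` (`δ > 0`), a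
continuous representation `ρ`, any `β`, any `nhit = n ≥ 1` and any scan `Ls` through all edges of the
torus: with `S` the Metropolis sweep for the weight `e^{−βS_W}` there is `ε ∈ (0, 1]` with
`|μ₀ (S^{k+1})ᵗ(A) − wilsonMeasure(A)| ≤ (1 − ε)ᵗ` for every initial law; and the Wilson measure is
the ONLY probability law invariant under `S`. -/
theorem wilson_metropolisSweep_uniformlyErgodic [ν.IsInvInvariant] [NeZero L] (hρ : Continuous ρ) (β : ℝ)
    {k : ℕ} {δ : ℝ≥0∞} (hcov : ∀ u : G, δ • haarProbability G ≤ nHit (mulWalk ν) k u) (hδ : 0 < δ)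
    {n : ℕ} (hn : 1 ≤ n) {Ls : List (Edge d L)} (hLs : ∀ e, e ∈ Ls) :
    ∃ ε : ℝ, 0 < ε ∧ ε ≤ 1 ∧
      (∀ (μ₀ : Measure (GaugeConfig d L G)) [IsProbabilityMeasure μ₀] (t : ℕ) (A : Set (GaugeConfig d L G)),
        |((fun m' : Measure (GaugeConfig d L G) => m'.bind (nHit (metropolisSweep ν
              (fun U : GaugeConfig d L G => Real.exp (-β * wilsonAction ρ U)) n Ls) (k + 1)))^[t] μ₀).real A
            - (wilsonMeasure (d := d) (L := L) ρ β).real A| ≤ (1 - ε) ^ t) ∧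
      ∀ (π' : Measure (GaugeConfig d L G)) [IsProbabilityMeasure π'],
        Kernel.Invariant (metropolisSweep ν (fun U : GaugeConfig d L G => Real.exp (-β * wilsonAction ρ U)) n Ls) π' →
          π' = wilsonMeasure (d := d) (L := L) ρ β := by
  obtain ⟨s₀, hlo, hhi, hwm⟩ := wilsonBoltzmann_pinched (d := d) (L := L) ρ hρ β
  have h := metropolisSweep_uniformlyErgodic (ι := Edge d L) hcov hδ hwm (Real.exp_pos (-s₀)) hlo hhi hn hLs
  rw [gibbsProbability_eq_wilsonMeasure] at h
  exact h

end Wilson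

/-! ## §2 `U(1)`: the `u1_2d` Metropolis sweep at every `step > 0` and every `nhit ≥ 1` -/

section U1

variable {ι : Type*} [DecidableEq ι] {s : ℝ}

/-- The `U(1)` sweep of `U1MetropolisSweepErgodic.lean` IS the generic sweep with the engine's
`U(1)` kick law (definitional). -/
theorem u1MetropolisSweep_eq_metropolisSweep (w : (ι → Circle) → ℝ) (n : ℕ) (Ls : List ι) :
    u1MetropolisSweep s w n Ls = metropolisSweep (u1KickLaw s) w n Ls := rfl

/-- **The engine's `U(1)` kicks cover**: for every `step = s > 0` some number of kicks (`2^j` with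
`(3/2)^j s ≥ π`) dominates `δ ·` Haar from every start, `δ > 0`. -/
theorem exists_u1Kick_cover (hs : 0 < s) :
    ∃ k : ℕ, ∃ δ : ℝ≥0∞, 0 < δ ∧ ∀ u : Circle, δ • haarProbability Circle ≤ nHit (mulWalk (u1KickLaw s)) k u := by
  obtain ⟨j, hj⟩ := pow_unbounded_of_one_lt (Real.pi / s) (by norm_num : (1 : ℝ) < 3 / 2)
  have hr : Real.pi ≤ doublingRadius s j := by
    rw [doublingRadius]
    exact ((div_lt_iff₀ hs).1 hj).le
  refine ⟨2 ^ j, (ENNReal.ofReal (2 * s))⁻¹ ^ 2 ^ j * (doublingConst s j * ENNReal.ofReal (2 * Real.pi)),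
    ENNReal.mul_pos (pow_ne_zero _ (ENNReal.inv_ne_zero.2 ENNReal.ofReal_ne_top))
      (mul_ne_zero (doublingConst_ne_zero hs j) (by rw [Ne, ENNReal.ofReal_eq_zero, not_le]; positivity)),
    fun u => u1Kick_nHit_minorised hs hr u⟩

variable {d L N : ℕ} (ρ : Circle →* Matrix (Fin N) (Fin N) ℂ)

/-- **THE `u1_2d` METROPOLIS SWEEP CONVERGES TO THE `U(1)` WILSON MEASURE AT EVERY `step > 0` AND
EVERY `nhit ≥ 1`** (the default `(1.0, 4)` included): for continuous `ρ`, any `β`, any scan through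
all edges there are `t` and `ε ∈ (0, 1]` with `|μ₀ (Sᵗ)^r(A) − wilsonMeasure(A)| ≤ (1 − ε)^r` for every
initial law `μ₀`, every `r`, every `A`; and the Wilson measure is the ONLY probability law
invariant under the sweep `S = u1MetropolisSweep s e^{−βS_W} n Ls`. -/
theorem wilson_u1MetropolisSweep_uniformlyErgodic_of_pos [NeZero L] (hρ : Continuous ρ) (β : ℝ)
    (hs : 0 < s) {n : ℕ} (hn : 1 ≤ n) {Ls : List (Edge d L)} (hLs : ∀ e, e ∈ Ls) :
    ∃ t : ℕ, ∃ ε : ℝ, 0 < ε ∧ ε ≤ 1 ∧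
      (∀ (μ₀ : Measure (GaugeConfig d L Circle)) [IsProbabilityMeasure μ₀] (r : ℕ)
          (A : Set (GaugeConfig d L Circle)),
        |((fun m' : Measure (GaugeConfig d L Circle) => m'.bind (nHit (u1MetropolisSweep s
              (fun U : GaugeConfig d L Circle => Real.exp (-β * wilsonAction ρ U)) n Ls) t))^[r] μ₀).real A
            - (wilsonMeasure (d := d) (L := L) ρ β).real A| ≤ (1 - ε) ^ r) ∧
      ∀ (π' : Measure (GaugeConfig d L Circle)) [IsProbabilityMeasure π'],
        Kernel.Invariant (u1MetropolisSweep s (fun U : GaugeConfig d L Circle => Real.exp (-β * wilsonAction ρ U)) n Ls) π' →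
          π' = wilsonMeasure (d := d) (L := L) ρ β := by
  obtain ⟨k, δ, hδ, hcov⟩ := exists_u1Kick_cover hs
  haveI := isProbabilityMeasure_u1KickLaw hs
  haveI := isInvInvariant_u1KickLaw s
  obtain ⟨ε, hε0, hε1, h⟩ := wilson_metropolisSweep_uniformlyErgodic (d := d) (L := L) ρ hρ β hcov hδ hn hLs
  exact ⟨k + 1, ε, hε0, hε1, h⟩

end U1

/-! ## §3 `SU(2)`: the engine's Metropolis sweep at every kick size and every `nhit ≥ 1` -/

section SU2

variable {s : ℝ} [Fact (0 < s)]

/-- **The engine's `SU(2)` kicks cover**: some number of kicks dominates `δ ·` Haar from every start. -/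
theorem exists_su2MetropolisKick_cover :
    ∃ k : ℕ, ∃ δ : ℝ≥0∞, 0 < δ ∧ ∀ u : Matrix.specialUnitaryGroup (Fin 2) ℂ,
      δ • haarProbability (Matrix.specialUnitaryGroup (Fin 2) ℂ) ≤ nHit (mulWalk (su2MetropolisKick s)) k u :=
  su2Kick_nHit_minorised (su2KickRadius_pos (Fact.out : 0 < s)).1 (su2KickRadius_pos (Fact.out : 0 < s)).2
    (su2KickConst_ne_zero (Fact.out : 0 < s)) smul_map_restrict_ball_le_su2MetropolisKick

variable {d L N : ℕ} (ρ : Matrix.specialUnitaryGroup (Fin 2) ℂ →* Matrix (Fin N) (Fin N) ℂ)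

/-- **THE ENGINE'S `SU(2)` METROPOLIS SWEEP CONVERGES TO THE `SU(2)` WILSON MEASURE** at every kick
size `s > 0` and every `nhit ≥ 1`: for continuous `ρ`, any `β`, any scan through all edges there are
`t` and `ε ∈ (0, 1]` with `|μ₀ (Sᵗ)^r(A) − wilsonMeasure(A)| ≤ (1 − ε)^r` for every initial law; and
the Wilson measure is the ONLY probability law invariant under the sweep
`S = metropolisSweep (su2MetropolisKick s) e^{−βS_W} n Ls`. -/
theorem wilson_su2MetropolisSweep_uniformlyErgodic [NeZero L] (hρ : Continuous ρ) (β : ℝ) {n : ℕ}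
    (hn : 1 ≤ n) {Ls : List (Edge d L)} (hLs : ∀ e, e ∈ Ls) :
    ∃ t : ℕ, ∃ ε : ℝ, 0 < ε ∧ ε ≤ 1 ∧
      (∀ (μ₀ : Measure (GaugeConfig d L (Matrix.specialUnitaryGroup (Fin 2) ℂ))) [IsProbabilityMeasure μ₀]
          (r : ℕ) (A : Set (GaugeConfig d L (Matrix.specialUnitaryGroup (Fin 2) ℂ))),
        |((fun m' : Measure (GaugeConfig d L (Matrix.specialUnitaryGroup (Fin 2) ℂ)) =>
              m'.bind (nHit (metropolisSweep (su2MetropolisKick s)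
                (fun U : GaugeConfig d L (Matrix.specialUnitaryGroup (Fin 2) ℂ) =>
                  Real.exp (-β * wilsonAction ρ U)) n Ls) t))^[r] μ₀).real A
            - (wilsonMeasure (d := d) (L := L) ρ β).real A| ≤ (1 - ε) ^ r) ∧
      ∀ (π' : Measure (GaugeConfig d L (Matrix.specialUnitaryGroup (Fin 2) ℂ))) [IsProbabilityMeasure π'],
        Kernel.Invariant (metropolisSweep (su2MetropolisKick s)
          (fun U : GaugeConfig d L (Matrix.specialUnitaryGroup (Fin 2) ℂ) => Real.exp (-β * wilsonAction ρ U))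
          n Ls) π' → π' = wilsonMeasure (d := d) (L := L) ρ β := by
  obtain ⟨k, δ, hδ, hcov⟩ := exists_su2MetropolisKick_cover (s := s)
  obtain ⟨ε, hε0, hε1, h⟩ := wilson_metropolisSweep_uniformlyErgodic (d := d) (L := L) ρ hρ β hcov hδ hn hLs
  exact ⟨k + 1, ε, hε0, hε1, h⟩

end SU2

end Summit.Ventures.LatticeQCDFlow.Exactness
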